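import Mathlib

/-!
# Slides are bounded by two-sided collisions ("twins ℓ²", defect side) — crux
# `SnSubsetDichotomy.HyperoctahedralThreshold` (stmt-MatrixMultiplication-10883), refutation line
# `refutation_local_symmetry`, open core `stub_poorRigidCore`; siege k22, variation "twins ℓ² argument"

Three involutions `μ b` of `Fin n` act on the right, `p · g := g.foldl (fun v b => μ b v) p`, and `g⁻¹ = g.reverse`.
A **slide** of split `(g, h)` at `p` (`g ∈ A`, `h ∈ B`, two finite sets of colour words) is a point fixed by both
`g ++ h` and its rotation `h ++ g`:  `p · (g h) = p` and `p · (h g) = p`.  These are exactly the cross-conflicts of the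
twin route (crux NOTES §4 `Ξ`, §11 "cross type"): `Ξ_z` at offset `|g|` for the word `z = g h` counts the points of
`Fix z ∩ Fix z^{(d)}`.  Writing `a := p · g`, `b := p · h`, a slide says `g : b ↦ p ↦ a` and `h : a ↦ p ↦ b` — the
"translation triple" of crux NOTES §12.1 — so with the TWO-STEP PROFILES
  `G(p, a, b) := #{g ∈ A : p · g = a, p · g⁻¹ = b}`,   `H(p, a, b) := #{h ∈ B : p · h = b, p · h⁻¹ = a}`
one has `#slides = Σ_{(p,a,b)} G · H`, and Cauchy–Schwarz over the middle point gives

  `slides_sq_le_twoSided`:   `#slides(A, B)² ≤ TS(A) · TS(B)`,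
  `TS(A) := #{(p, g, g') ∈ V × A × A : p · g = p · g' ∧ p · g⁻¹ = p · g'⁻¹}`  (two-sided collisions, `= Σ G²`).

This is the ℓ² form of the reduction "slides ⇐ (TSA)" (crux NOTES §12.1: `Tr_d ≤ Σ_x ‖a_x‖₂ ‖b_x‖₂`), stated for
ARBITRARY word sets `A`, `B` (the user takes reduced words of lengths `d` and `ℓ - d`, with whatever end-letter
constraints); it turns a bound on two-sided collisions — the atom (TSA) — into a bound on the slide count that
`stub_slideBound` (p108343) consumes.  Pure finite combinatorics; no definitions.  NOT here: any bound on `TS` itself.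
-/

-- the problem path `MatrixMultiplication/MatrixMultiplication` (single-conjunct summit) duplicates a namespace segment
set_option linter.dupNamespace false

namespace Summit.MatrixMultiplication.MatrixMultiplication.Theorems.HyperoctahedralThreshold.SlidesTwoSided

open Finset

variable {n : ℕ}

/-- Walking back along the reversed word undoes the walk (letters are involutions); private copy of the one-liner of
the sibling files of this line. -/
private theorem foldl_act_reverse (μ : Fin 3 → Equiv.Perm (Fin n)) (hμ : ∀ b, μ b * μ b = 1) :
    ∀ (w : List (Fin 3)) (x : Fin n), w.reverse.foldl (fun v b => μ b v) (w.foldl (fun v b => μ b v) x) = x := by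
  intro w
  induction w with
  | nil => intro x; rfl
  | cons c w ih =>
    intro x
    rw [List.foldl_cons, List.reverse_cons, List.foldl_append, ih]
    show μ c (μ c x) = x
    have : (μ c * μ c) x = x := by rw [hμ c]; rfl
    simpa using this

/-- Transport duality: `a · h = p ↔ p · h⁻¹ = a`. -/
theorem act_eq_iff_reverse_act_eq (μ : Fin 3 → Equiv.Perm (Fin n)) (hμ : ∀ b, μ b * μ b = 1)
    (h : List (Fin 3)) (a p : Fin n) :
    h.foldl (fun v b => μ b v) a = p ↔ h.reverse.foldl (fun v b => μ b v) p = a := by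
  constructor
  · rintro rfl
    exact foldl_act_reverse μ hμ h a
  · rintro rfl
    have := foldl_act_reverse μ hμ h.reverse p
    rwa [List.reverse_reverse] at this

/-- The slide set, fibred over the middle point and the two transported points `(p, p · g, p · h)`, has fibres
`G(p,a,b) × H(p,a,b)`. -/
theorem card_slides_eq_sum (μ : Fin 3 → Equiv.Perm (Fin n)) (hμ : ∀ b, μ b * μ b = 1)
    (A B : Finset (List (Fin 3))) :
    (((Finset.univ : Finset (Fin n)) ×ˢ (A ×ˢ B)).filter (fun q =>
        (q.2.1 ++ q.2.2).foldl (fun v b => μ b v) q.1 = q.1 ∧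
        (q.2.2 ++ q.2.1).foldl (fun v b => μ b v) q.1 = q.1)).card =
      ∑ c ∈ (Finset.univ : Finset (Fin n × Fin n × Fin n)),
        (A.filter (fun g => g.foldl (fun v b => μ b v) c.1 = c.2.1 ∧
            g.reverse.foldl (fun v b => μ b v) c.1 = c.2.2)).card *
        (B.filter (fun h => h.foldl (fun v b => μ b v) c.1 = c.2.2 ∧
            h.reverse.foldl (fun v b => μ b v) c.1 = c.2.1)).card := by
  rw [Finset.card_eq_sum_card_fiberwise
    (f := fun q : Fin n × List (Fin 3) × List (Fin 3) =>
      (q.1, q.2.1.foldl (fun v b => μ b v) q.1, q.2.2.foldl (fun v b => μ b v) q.1))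
    (t := (Finset.univ : Finset (Fin n × Fin n × Fin n))) (fun _ _ => Finset.mem_coe.2 (Finset.mem_univ _))]
  refine Finset.sum_congr rfl (fun c _ => ?_)
  rw [← Finset.card_product]
  refine Finset.card_nbij' (fun q => (q.2.1, q.2.2)) (fun r => (c.1, r.1, r.2)) ?_ ?_ ?_ ?_
  · intro q hq
    rw [Finset.mem_coe, Finset.mem_filter, Finset.mem_filter, Finset.mem_product, Finset.mem_product] at hq
    obtain ⟨⟨⟨-, hg, hh⟩, h1, h2⟩, hc⟩ := hq
    subst hc
    rw [List.foldl_append] at h1 h2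
    rw [Finset.mem_coe, Finset.mem_product, Finset.mem_filter, Finset.mem_filter]
    exact ⟨⟨hg, rfl, (act_eq_iff_reverse_act_eq μ hμ _ _ _).1 h2⟩,
      ⟨hh, rfl, (act_eq_iff_reverse_act_eq μ hμ _ _ _).1 h1⟩⟩
  · intro r hr
    rw [Finset.mem_coe, Finset.mem_product, Finset.mem_filter, Finset.mem_filter] at hr
    obtain ⟨⟨hg, hg1, hg2⟩, hh, hh1, hh2⟩ := hr
    rw [Finset.mem_coe, Finset.mem_filter, Finset.mem_filter, Finset.mem_product, Finset.mem_product]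
    refine ⟨⟨⟨Finset.mem_univ _, hg, hh⟩, ?_, ?_⟩, ?_⟩
    · rw [List.foldl_append, hg1]
      exact (act_eq_iff_reverse_act_eq μ hμ _ _ _).2 hh2
    · rw [List.foldl_append, hh1]
      exact (act_eq_iff_reverse_act_eq μ hμ _ _ _).2 hg2
    · simp only [hg1, hh1]
  · intro q hq
    rw [Finset.mem_coe, Finset.mem_filter] at hq
    obtain ⟨-, hc⟩ := hq
    subst hc
    rfl
  · intro r _
    rfl

/-- The two-sided collision set, fibred over `(p, p · g, p · g⁻¹)`, has fibres `G(p,a,b) × G(p,a,b)`. -/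
theorem card_twoSided_eq_sum (μ : Fin 3 → Equiv.Perm (Fin n)) (A : Finset (List (Fin 3))) :
    (((Finset.univ : Finset (Fin n)) ×ˢ (A ×ˢ A)).filter (fun q =>
        q.2.1.foldl (fun v b => μ b v) q.1 = q.2.2.foldl (fun v b => μ b v) q.1 ∧
        q.2.1.reverse.foldl (fun v b => μ b v) q.1 = q.2.2.reverse.foldl (fun v b => μ b v) q.1)).card =
      ∑ c ∈ (Finset.univ : Finset (Fin n × Fin n × Fin n)),
        (A.filter (fun g => g.foldl (fun v b => μ b v) c.1 = c.2.1 ∧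
            g.reverse.foldl (fun v b => μ b v) c.1 = c.2.2)).card ^ 2 := by
  rw [Finset.card_eq_sum_card_fiberwise
    (f := fun q : Fin n × List (Fin 3) × List (Fin 3) =>
      (q.1, q.2.1.foldl (fun v b => μ b v) q.1, q.2.1.reverse.foldl (fun v b => μ b v) q.1))
    (t := (Finset.univ : Finset (Fin n × Fin n × Fin n))) (fun _ _ => Finset.mem_coe.2 (Finset.mem_univ _))]
  refine Finset.sum_congr rfl (fun c _ => ?_)
  rw [sq, ← Finset.card_product]
  refine Finset.card_nbij' (fun q => (q.2.1, q.2.2)) (fun r => (c.1, r.1, r.2)) ?_ ?_ ?_ ?_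
  · intro q hq
    rw [Finset.mem_coe, Finset.mem_filter, Finset.mem_filter, Finset.mem_product, Finset.mem_product] at hq
    obtain ⟨⟨⟨-, hg, hg'⟩, h1, h2⟩, hc⟩ := hq
    subst hc
    rw [Finset.mem_coe, Finset.mem_product, Finset.mem_filter, Finset.mem_filter]
    exact ⟨⟨hg, rfl, rfl⟩, ⟨hg', h1.symm, h2.symm⟩⟩
  · intro r hr
    rw [Finset.mem_coe, Finset.mem_product, Finset.mem_filter, Finset.mem_filter] at hr
    obtain ⟨⟨hg, hg1, hg2⟩, hg', hg'1, hg'2⟩ := hr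
    rw [Finset.mem_coe, Finset.mem_filter, Finset.mem_filter, Finset.mem_product, Finset.mem_product]
    refine ⟨⟨⟨Finset.mem_univ _, hg, hg'⟩, ?_, ?_⟩, ?_⟩
    · rw [hg1, hg'1]
    · rw [hg2, hg'2]
    · simp only [hg1, hg2]
  · intro q hq
    rw [Finset.mem_coe, Finset.mem_filter] at hq
    obtain ⟨-, hc⟩ := hq
    subst hc
    rfl
  · intro r _
    rfl

/-- **Slides are bounded by two-sided collisions** (crux NOTES §12.1, Cauchy–Schwarz over the middle point of a
translation triple).  For any two finite sets of colour words `A`, `B`: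
`#{(p, g, h) ∈ V × A × B : p·(g h) = p, p·(h g) = p}² ≤ TS(A) · TS(B)` with
`TS(A) = #{(p, g, g') ∈ V × A × A : p·g = p·g', p·g⁻¹ = p·g'⁻¹}`. [folklore; crux NOTES §12.1] -/
theorem slides_sq_le_twoSided (μ : Fin 3 → Equiv.Perm (Fin n)) (hμ : ∀ b, μ b * μ b = 1)
    (A B : Finset (List (Fin 3))) :
    (((Finset.univ : Finset (Fin n)) ×ˢ (A ×ˢ B)).filter (fun q =>
        (q.2.1 ++ q.2.2).foldl (fun v b => μ b v) q.1 = q.1 ∧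
        (q.2.2 ++ q.2.1).foldl (fun v b => μ b v) q.1 = q.1)).card ^ 2 ≤
      (((Finset.univ : Finset (Fin n)) ×ˢ (A ×ˢ A)).filter (fun q =>
        q.2.1.foldl (fun v b => μ b v) q.1 = q.2.2.foldl (fun v b => μ b v) q.1 ∧
        q.2.1.reverse.foldl (fun v b => μ b v) q.1 = q.2.2.reverse.foldl (fun v b => μ b v) q.1)).card *
      (((Finset.univ : Finset (Fin n)) ×ˢ (B ×ˢ B)).filter (fun q =>
        q.2.1.foldl (fun v b => μ b v) q.1 = q.2.2.foldl (fun v b => μ b v) q.1 ∧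
        q.2.1.reverse.foldl (fun v b => μ b v) q.1 = q.2.2.reverse.foldl (fun v b => μ b v) q.1)).card := by
  rw [card_slides_eq_sum μ hμ A B, card_twoSided_eq_sum μ A, card_twoSided_eq_sum μ B]
  -- re-index the `B` sum by the swap `(p, a, b) ↦ (p, b, a)` so that both profiles live on the same key
  have hswap : ∑ c ∈ (Finset.univ : Finset (Fin n × Fin n × Fin n)),
      (B.filter (fun g => g.foldl (fun v b => μ b v) c.1 = c.2.1 ∧
          g.reverse.foldl (fun v b => μ b v) c.1 = c.2.2)).card ^ 2 =
      ∑ c ∈ (Finset.univ : Finset (Fin n × Fin n × Fin n)),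
      (B.filter (fun h => h.foldl (fun v b => μ b v) c.1 = c.2.2 ∧
          h.reverse.foldl (fun v b => μ b v) c.1 = c.2.1)).card ^ 2 := by
    refine Finset.sum_nbij' (fun c => (c.1, c.2.2, c.2.1)) (fun c => (c.1, c.2.2, c.2.1)) ?_ ?_ ?_ ?_ ?_
    · intro c _; exact Finset.mem_univ _
    · intro c _; exact Finset.mem_univ _
    · intro c _; rfl
    · intro c _; rfl
    · intro c _; rfl
  rw [hswap]
  exact Finset.sum_mul_sq_le_sq_mul_sq _ _ _

/-- **Registered form** (`stub_slidesTwoSided`, a `--supports` helper for the open core `stub_poorRigidCore` of crux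
`stmt-MatrixMultiplication-10883`): `slides_sq_le_twoSided`, fully quantified. -/
theorem stub_slidesTwoSided : ∀ (n : ℕ) (μ : Fin 3 → Equiv.Perm (Fin n)) (A B : Finset (List (Fin 3))), (∀ b, μ b * μ b = 1) → (((Finset.univ : Finset (Fin n)) ×ˢ (A ×ˢ B)).filter (fun q => (q.2.1 ++ q.2.2).foldl (fun v b => μ b v) q.1 = q.1 ∧ (q.2.2 ++ q.2.1).foldl (fun v b => μ b v) q.1 = q.1)).card ^ 2 ≤ (((Finset.univ : Finset (Fin n)) ×ˢ (A ×ˢ A)).filter (fun q => q.2.1.foldl (fun v b => μ b v) q.1 = q.2.2.foldl (fun v b => μ b v) q.1 ∧ q.2.1.reverse.foldl (fun v b => μ b v) q.1 = q.2.2.reverse.foldl (fun v b => μ b v) q.1)).card * (((Finset.univ : Finset (Fin n)) ×ˢ (B ×ˢ B)).filter (fun q => q.2.1.foldl (fun v b => μ b v) q.1 = q.2.2.foldl (fun v b => μ b v) q.1 ∧ q.2.1.reverse.foldl (fun v b => μ b v) q.1 = q.2.2.reverse.foldl (fun v b => μ b v) q.1)).card :=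
  fun _ μ A B hμ => slides_sq_le_twoSided μ hμ A B

end Summit.MatrixMultiplication.MatrixMultiplication.Theorems.HyperoctahedralThreshold.SlidesTwoSided
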